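import Literature.NumberTheory.Automorphic.SmoothRepresentation
import Mathlib.Topology.Algebra.Group.Basic
import Mathlib.NumberTheory.Padics.PadicNumbers
import Mathlib.Data.Complex.Basic
import HarnessLib

/-!
# Smoothness of a representation is a genuine condition

`Representation.IsSmooth ρ` (file `Literature.NumberTheory.Automorphic.SmoothRepresentation`,
citing Bernstein–Zelevinsky 1976, Definition 2.1; verbatim in Bump 1997, §4.2, p. 423: "we say
that `π` is smooth if for any `v ∈ V` the stabilizer `{g ∈ G | π(g) v = v}` is open") is a
**definition** — a predicate on representations `ρ` of a topological group `G` on a module with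
no topology — not a closed proposition to be discharged. This file records the elementary, fully
proved facts that locate the predicate between its two extremes:

* `Representation.isSmooth_of_discreteTopology`: every representation of a discrete group is
  smooth (in particular every representation of a finite group with the discrete topology);
* `Representation.isSmooth_of_isTrivial`: a representation through which `G` acts trivially
  (Mathlib `Representation.IsTrivial`) is smooth, whatever the topology on `G` (the case of
  `Representation.trivial` is already `Representation.isSmooth_trivial` in
  `MatrixCoefficientsTrivialRep.lean`);
* `Representation.stabilizerSubgroup_leftRegular_single`: in the left regular representation of
  `G` on the monoid algebra `k[G]` (Mathlib `MonoidAlgebra k G`, `Representation.leftRegular`)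
  the stabiliser of a basis vector `single h r`, `r ≠ 0`, is the trivial subgroup;
* `Representation.isSmooth_leftRegular_iff`: for a nontrivial coefficient ring, `k[G]` is smooth
  iff `G` is discrete;
* `Representation.not_isSmooth_leftRegular_padic`: hence the regular representation of the
  additive group of `ℚ_p` (a locally profinite, non-discrete group) on `ℂ[ℚ_p]` is **not**
  smooth, and `Representation.not_forall_isSmooth`: the universal closure `∀ ρ, ρ.IsSmooth` of
  the predicate is false.

These are the standard first remarks after the definition (Bump 1997, §4.2, p. 423,
"smoothness is a substitute for a topological condition"; Bushnell–Henniart 2006, §1.1); no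
single source states them as numbered results, so they are tagged folklore.

## Design notes

* All declarations are deliberate dot-notation extensions of Mathlib's `namespace Representation`,
  exactly as in `SmoothRepresentation.lean` (`ρ.IsSmooth`, `ρ.stabilizerSubgroup`).
* Generality: `isSmooth_leftRegular_iff` needs only `[SeparatelyContinuousMul G]` (to identify
  discreteness with openness of `{1}`, Mathlib `discreteTopology_iff_isOpen_singleton_one`) and
  `[Nontrivial k]` (over the zero ring `k[G] = 0` is smooth for every `G`).
* The concrete non-example uses `Multiplicative ℚ_[p]` (Mathlib representations are of
  multiplicative monoids); non-discreteness of `ℚ_[p]` is `NormedField.nhdsNE_neBot` for the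
  nontrivially normed field `ℚ_[p]`.

## References

* I. N. Bernstein, A. V. Zelevinsky, *Representations of the group `GL(n, F)` where `F` is a
  non-archimedean local field*, Russian Math. Surveys 31:3 (1976), 1–68, §2.1
  (doi:10.1070/RM1976v031n03ABEH001532; not held in the literature store at the time of
  writing). [BernsteinZelevinsky1976]
* D. Bump, *Automorphic Forms and Representations*, Cambridge Studies in Advanced Mathematics 55
  (1997), §4.2, p. 423. [Bump1997]
* C. J. Bushnell, G. Henniart, *The local Langlands conjecture for `GL(2)`* (2006), §1.1.
-/

namespace Representation

section General

variable {k G V : Type*} [CommRing k] [Group G] [AddCommGroup V] [Module k V]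
  [TopologicalSpace G]

/-- Every representation of a **discrete** group is smooth: all stabilisers are open because
every subset is. (Bump 1997, §4.2, p. 423; immediate from the definition.) [folklore] -/
theorem isSmooth_of_discreteTopology [DiscreteTopology G] (ρ : Representation k G V) :
    ρ.IsSmooth :=
  fun _ => isOpen_discrete _

/-- A representation through which `G` acts trivially (Mathlib `Representation.IsTrivial`) is
smooth for any topology on `G`: every stabiliser is all of `G`. (The special case of
`Representation.trivial k G V` is `Representation.isSmooth_trivial` in
`Literature.NumberTheory.Automorphic.MatrixCoefficientsTrivialRep`.) [folklore] -/
theorem isSmooth_of_isTrivial (ρ : Representation k G V) [ρ.IsTrivial] : ρ.IsSmooth := by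
  intro v
  have h : ρ.stabilizerSubgroup v = ⊤ := by
    ext g
    simp only [mem_stabilizerSubgroup, isTrivial_apply, Subgroup.mem_top]
  rw [IsSmoothVector, h, Subgroup.coe_top]
  exact isOpen_univ

end General

section LeftRegular

variable {k G : Type*} [CommRing k] [Group G]

/-- In the left regular representation of `G` on the monoid algebra `k[G]`
(`g · single h r = single (g h) r`, Mathlib `Representation.ofMulAction_single`) the stabiliser
of a basis vector `single h r` with `r ≠ 0` is the trivial subgroup. [folklore] -/
theorem stabilizerSubgroup_leftRegular_single (h : G) {r : k} (hr : r ≠ 0) :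
    (leftRegular k G).stabilizerSubgroup (MonoidAlgebra.single h r) = ⊥ := by
  ext g
  rw [mem_stabilizerSubgroup, Subgroup.mem_bot, ofMulAction_single, smul_eq_mul,
    MonoidAlgebra.single_left_inj hr, mul_eq_right]

variable [TopologicalSpace G]

/-- The left regular representation `k[G]` of a topological group `G` over a nontrivial
commutative ring `k` is smooth **iff `G` is discrete**: the stabiliser of `single 1 1` is `{1}`,
which is open iff the topology is discrete (`discreteTopology_iff_isOpen_singleton_one`).
(Bump 1997, §4.2, p. 423, "smoothness is a substitute for a topological condition".)
[folklore] -/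
theorem isSmooth_leftRegular_iff [Nontrivial k] [SeparatelyContinuousMul G] :
    (leftRegular k G).IsSmooth ↔ DiscreteTopology G := by
  constructor
  · intro h
    apply discreteTopology_of_isOpen_singleton_one
    have h1 := h (MonoidAlgebra.single 1 1)
    rwa [IsSmoothVector, stabilizerSubgroup_leftRegular_single (k := k) 1 one_ne_zero,
      Subgroup.coe_bot] at h1
  · intro _
    exact isSmooth_of_discreteTopology _

/-- Over a nontrivial ring, the left regular representation of a **non-discrete** topological
group is not smooth. [folklore] -/
theorem not_isSmooth_leftRegular [Nontrivial k] [SeparatelyContinuousMul G]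
    (hG : ¬ DiscreteTopology G) : ¬ (leftRegular k G).IsSmooth :=
  fun h => hG (isSmooth_leftRegular_iff.1 h)

end LeftRegular

section Padic

/-- The additive group of `ℚ_p` is not discrete: `{0}` is not open in the nontrivially normed
field `ℚ_[p]` (`NormedField.nhdsNE_neBot`), transported to the multiplicative copy
`Multiplicative ℚ_[p]` (same topology, `1 = ofAdd 0`). [folklore] -/
theorem not_discreteTopology_multiplicative_padic (p : ℕ) [Fact p.Prime] :
    ¬ DiscreteTopology (Multiplicative ℚ_[p]) := by
  intro h
  have h1 : IsOpen ({1} : Set (Multiplicative ℚ_[p])) :=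
    discreteTopology_iff_isOpen_singleton_one.1 h
  exact not_isOpen_singleton (0 : ℚ_[p]) h1

/-- **Non-example.** The regular representation of the (additive group of the) locally
profinite field `ℚ_p` on `ℂ[ℚ_p]` is not smooth: the stabiliser of the basis vector at `0` is
trivial and `ℚ_p` is not discrete. [folklore] -/
theorem not_isSmooth_leftRegular_padic (p : ℕ) [Fact p.Prime] :
    ¬ (leftRegular ℂ (Multiplicative ℚ_[p])).IsSmooth :=
  not_isSmooth_leftRegular (not_discreteTopology_multiplicative_padic p)

/-- `Representation.IsSmooth` is a proper predicate, not a theorem: its universal closure over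
all complex representations of the locally profinite group `(ℚ_2, +)` is false (witness: the
regular representation, `not_isSmooth_leftRegular_padic`). [folklore] -/
theorem not_forall_isSmooth :
    ¬ ∀ (V : Type) [AddCommGroup V] [Module ℂ V]
        (ρ : Representation ℂ (Multiplicative ℚ_[2]) V), ρ.IsSmooth := by
  intro h
  haveI : Fact (Nat.Prime 2) := ⟨Nat.prime_two⟩
  exact not_isSmooth_leftRegular_padic 2
    (h (MonoidAlgebra ℂ (Multiplicative ℚ_[2])) (leftRegular ℂ _))

end Padic

end Representation
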